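import Mathlib
import Literature.NumberTheory.EllipticCurves.TwoVariablePAdicLFunctionK

/-!
# Sketch — crux-ideate round 1, ideator 1, crux `VerticalSelmerBound` (stmt-BirchSwinnertonDyer-18432)

First lemmas of the two crux ideas filed by this seat:

* `crossing-multiplicity` — the two-variable (weight × anticyclotomic) Selmer module localised at the
  height-two prime `𝔭` of the crossing point `(κ₂, 𝟙)`: the number of generators of `X_𝔭` (= the
  Selmer corank `s` by point control) bounds below the `𝔭`-adic order of `det` of a minimal
  presentation, hence of `char X`, hence (two-variable IMC near `𝔭`) of the two-variable `p`-adic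
  `L`-function `L`, so `L ∈ 𝔭^s`; then every point of the slanted arc at depth `N` has
  `|L| ≤ p^{-s(N+1)+O(1)}`.  Lemmas: `det_mem_pow_of_forall_mem` (proved),
  `mem_pow_of_isUnit_mul_eq_det` (proved), `norm_value_le_of_vanishing_below` (signature: the
  evaluation half, over the tree's two-variable receptacle `CycAntiSeries` / `HasValueAt`, outer
  variable read as the WEIGHT variable `x = κ(u) - 1`, inner as the anticyclotomic `y = σ(γ) - 1`).
* `deep-artinian-slice` — finite-slice Euler bound at the deep artinian twist: Howard's rigidity at the
  empty conductor (`Sel ≅ M ⊕ M`, `len M ≤ ord λ₁`) + the bottom layer `E[p^{N+1}]^{⊕ s} ↪ Sel` give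
  `(N+1)s ≤ 2·ord θ_g(χ̂_k) + c`.  Lemma: `deepSlice_exponent_bound` (proved; the composition of the
  line in exponent form).
-/

namespace Summit.BirchSwinnertonDyer.BirchSwinnertonDyer.Cruxes.VerticalSelmerBound.Ideate1

set_option linter.dupNamespace false

open scoped BigOperators

/-! ### `crossing-multiplicity` -/

/-- The determinant of an `n × n` matrix with all entries in an ideal `I` lies in `I ^ n`
(Leibniz expansion: every term is `±` a product of `n` entries).  Applied to a MINIMAL presentation
matrix of the localised two-variable Selmer module `X_𝔭` (entries in `𝔭 A_𝔭`, size `μ(X_𝔭) ≥ s`). -/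
theorem det_mem_pow_of_forall_mem {R : Type*} [CommRing R] {n : ℕ} (I : Ideal R)
    (Φ : Matrix (Fin n) (Fin n) R) (h : ∀ i j, Φ i j ∈ I) : Φ.det ∈ I ^ n := by
  rw [Matrix.det_apply]
  refine Ideal.sum_mem _ fun σ _ => ?_
  have hprod : (∏ i, Φ (σ i) i) ∈ I ^ n := by
    have h1 : (∏ i : Fin n, Φ (σ i) i) ∈ ∏ _i : Fin n, I :=
      Ideal.prod_mem_prod fun i _ => h (σ i) i
    simpa [Finset.prod_const, Finset.card_univ, Fintype.card_fin] using h1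
  rw [Units.smul_def]
  exact zsmul_mem hprod _

/-- **First lemma of `crossing-multiplicity` (algebraic half).**  If, locally at the crossing prime
`𝔭`, the two-variable `p`-adic `L`-function `L` generates the characteristic ideal up to a unit
(two-variable IMC: `L * u = char X = det Φ` for a minimal presentation `Φ` of `X_𝔭`, whose entries lie
in `𝔭` and whose size is the fibre rank `s`), then `L ∈ 𝔭 ^ s`. -/
theorem mem_pow_of_isUnit_mul_eq_det {A : Type*} [CommRing A] (𝔭 : Ideal A) {s : ℕ}
    (Φ : Matrix (Fin s) (Fin s) A) (hΦ : ∀ i j, Φ i j ∈ 𝔭) (L u : A) (hu : IsUnit u)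
    (hIMC : L * u = Φ.det) : L ∈ 𝔭 ^ s := by
  obtain ⟨w, rfl⟩ := hu
  have hL : L = Φ.det * ↑w⁻¹ := by
    rw [← hIMC, mul_assoc, Units.mul_inv, mul_one]
  rw [hL]
  exact Ideal.mul_mem_right _ _ (det_mem_pow_of_forall_mem 𝔭 Φ hΦ)

open Literature.NumberTheory.EllipticCurves in
/-- **First lemma of `crossing-multiplicity` (analytic half, signature).**  A two-variable series with
`ℤ_p`-bounded coefficients all of whose coefficients of total degree `< s` vanish (i.e. `L ∈ (x, y)^s`
in `ℤ_p⟦x, y⟧`) has values of norm `≤ r ^ s` on the closed bidisc of radius `r < 1`; on the branch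
`2(p-1)p^N ∣ k-2` both coordinates `x = u^{k-2} - 1`, `y = χ̂_k(γ) - 1` of the slanted-arc point have
norm `≤ p^{-(N+1)}`, so `|L(κ_k, χ̂_k)| ≤ p^{-s(N+1)}`.  (Receptacle: the tree's `CycAntiSeries p =
ℚ_p⟦y⟧⟦x⟧` and `HasValueAt`; here the OUTER variable is read as the weight variable.) -/
def norm_value_le_of_vanishing_below (p : ℕ) [Fact p.Prime] : Prop :=
  ∀ (L : CycAntiSeries p) (s : ℕ),
    (∀ j k : ℕ, ‖PowerSeries.coeff k (PowerSeries.coeff j L)‖ ≤ 1) →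
    (∀ j k : ℕ, j + k < s → PowerSeries.coeff k (PowerSeries.coeff j L) = 0) →
    ∀ (x y v : ℂ_[p]) (r : ℝ), 0 ≤ r → r < 1 → ‖x‖ ≤ r → ‖y‖ ≤ r →
      HasValueAt L x y v → ‖v‖ ≤ r ^ s

open Literature.NumberTheory.EllipticCurves in
/-- Proof of the analytic half (ultrametric estimate, term by term). -/
theorem norm_value_le_of_vanishing_below_holds (p : ℕ) [Fact p.Prime] :
    norm_value_le_of_vanishing_below p := by
  intro L s hint hvan x y v r hr0 hr1 hx hy hv
  rw [← hv.tsum_eq]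
  refine IsUltrametricDist.norm_tsum_le_of_forall_le_of_nonneg (pow_nonneg hr0 s) fun jk => ?_
  rcases lt_or_ge (jk.1 + jk.2) s with hlt | hle
  · rw [hvan jk.1 jk.2 hlt, map_zero, zero_mul, zero_mul, norm_zero]
    exact pow_nonneg hr0 s
  · calc ‖algebraMap ℚ_[p] ℂ_[p] (PowerSeries.coeff jk.2 (PowerSeries.coeff jk.1 L)) *
            x ^ jk.1 * y ^ jk.2‖
          = ‖algebraMap ℚ_[p] ℂ_[p] (PowerSeries.coeff jk.2 (PowerSeries.coeff jk.1 L))‖ *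
            ‖x‖ ^ jk.1 * ‖y‖ ^ jk.2 := by
            rw [norm_mul, norm_mul, norm_pow, norm_pow]
      _ ≤ 1 * r ^ jk.1 * r ^ jk.2 := by
            have hc : ‖algebraMap ℚ_[p] ℂ_[p] (PowerSeries.coeff jk.2 (PowerSeries.coeff jk.1 L))‖ ≤ 1 := by
              rw [norm_algebraMap']; exact hint _ _
            have hxj : ‖x‖ ^ jk.1 ≤ r ^ jk.1 := pow_le_pow_left₀ (norm_nonneg _) hx _
            have hyk : ‖y‖ ^ jk.2 ≤ r ^ jk.2 := pow_le_pow_left₀ (norm_nonneg _) hy _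
            have h1 := mul_le_mul hc hxj (pow_nonneg (norm_nonneg _) _) zero_le_one
            exact mul_le_mul h1 hyk (pow_nonneg (norm_nonneg _) _)
              (mul_nonneg zero_le_one (pow_nonneg hr0 _))
      _ = r ^ (jk.1 + jk.2) := by rw [one_mul, pow_add]
      _ ≤ r ^ s := pow_le_pow_of_le_one hr0 hr1.le hle

/-! ### `deep-artinian-slice` -/

/-- **First lemma of `deep-artinian-slice` (the composition in exponent form).**  `S = #Sel_𝓕(K, T_{M'})`
for the deep artinian self-dual twist `T_{M'} = T_g(χ̂_k⁻¹)/ϖ^{M'}` of the congruent weight-`k` form,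
`M = #M₁` where `Sel ≅ M₁ ⊕ M₁` (Howard 2006, structure at the empty conductor, even vertex),
bottom layer `p^{(N+1)s} ≤ S · p^c` (`E[p^{N+1}] = T_{M'}[ϖ^{e(N+1)}]` and the divisible part of
`Sel_{p^∞}(E/K)`), Euler bound `M ≤ p^t` with `t = ord λ₁ = ord θ_g(χ̂_k)` (Howard 2006, Thm. 2.3.7 at
`n = 1`).  Conclusion: `(N+1)·s ≤ 2t + c`, i.e. the crux's `j ≥ (N+1)s - C'` with `j = 2t`. -/
theorem deepSlice_exponent_bound (p : ℕ) (hp : 1 < p) (S M N s t c : ℕ)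
    (hsq : S = M ^ 2) (hbottom : p ^ ((N + 1) * s) ≤ S * p ^ c) (heuler : M ≤ p ^ t) :
    (N + 1) * s ≤ 2 * t + c := by
  have h1 : p ^ ((N + 1) * s) ≤ p ^ (2 * t + c) := by
    calc p ^ ((N + 1) * s) ≤ S * p ^ c := hbottom
      _ = M ^ 2 * p ^ c := by rw [hsq]
      _ ≤ (p ^ t) ^ 2 * p ^ c := Nat.mul_le_mul_right _ (Nat.pow_le_pow_left heuler 2)
      _ = p ^ (2 * t + c) := by rw [← pow_mul, ← pow_add, Nat.mul_comm t 2]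
  exact (Nat.pow_le_pow_iff_right hp).mp h1

end Summit.BirchSwinnertonDyer.BirchSwinnertonDyer.Cruxes.VerticalSelmerBound.Ideate1
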